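import Mathlib
import Literature.NumberTheory.Sieve.HeathBrownCubicLemma81Inputs
import HarnessLib

/-!
# Route ParityLeakOneFifth, crux `PlainSplit` (stmt-Parity-18382), skeleton `calib-split`:
# tools for stub `stub_roughLiouvilleTwistedSmall`, VI — parameters and growth

With `t = log log x` (`log x = e^t`), `z = e^{t²}`, `y = x^{1/5}`, `D = x^{1/2−2ε}`, `w = x^{ε²}`,
`L = x^{1/8}`: the parameter inequalities used by the stub (`twisted_params`), the
Bombieri–Vinogradov level at every `X' ∈ [x^{3/8}, 2x+2]` (`twisted_level`), and the three final
comparisons of the main, `L²` and remainder totals with `δ V x/(4 log x)` (`twisted_main_le`,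
`twisted_Lsq_le`, `twisted_rem_le`).
-/

namespace Summit.Parity.GeneralizedHardyLittlewood.Theorems.ParityLeakOneFifth

open Finset

/-- **The parameters.**  For `0 < ε ≤ 1/25`, `t ≥ 2` with `x = e^{e^t}` and `t² ≤ ε² e^t`:
`x ≥ 4`, `2 < z ≤ w ≤ L`, `w ≤ y`, `1 < y ≤ D ≤ x^{1/2}`, `1 ≤ L`, and the logarithms of `w`, `L`. -/
theorem twisted_params {ε : ℝ} (hε : 0 < ε) (hε25 : ε ≤ 1 / 25) {x t : ℝ} (hx0 : 0 < x)
    (hxexp : Real.exp (Real.exp t) = x) (ht2 : 2 ≤ t) (hT₂ : 1 / ε ^ 2 * t ^ 2 ≤ Real.exp t) :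
    4 ≤ x ∧ 2 < Real.exp (t ^ 2) ∧ Real.exp (t ^ 2) ≤ x ^ (ε ^ 2) ∧
    x ^ (ε ^ 2) ≤ x ^ ((1 : ℝ) / 8) ∧ x ^ (ε ^ 2) ≤ x ^ ((1 : ℝ) / 5) ∧ 1 < x ^ ((1 : ℝ) / 5) ∧
    x ^ ((1 : ℝ) / 5) ≤ x ^ ((1 : ℝ) / 2 - 2 * ε) ∧ x ^ ((1 : ℝ) / 2 - 2 * ε) ≤ x ^ ((1 : ℝ) / 2) ∧
    1 ≤ x ^ ((1 : ℝ) / 8) ∧ Real.log (x ^ (ε ^ 2)) = ε ^ 2 * Real.exp t ∧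
    Real.log (x ^ ((1 : ℝ) / 8)) = 1 / 8 * Real.exp t ∧ Real.log x = Real.exp t ∧
    x ^ ((1 : ℝ) / 2) = Real.exp (Real.exp t / 2) := by
  have hlogx : Real.log x = Real.exp t := by rw [← hxexp, Real.log_exp]
  have hε2 : 0 < ε ^ 2 := by positivity
  have hx4 : 4 ≤ x := by
    have h1 : Real.exp 2 ≤ Real.exp (Real.exp t) :=
      Real.exp_le_exp.2 (by linarith [Real.add_one_le_exp t])
    rw [hxexp] at h1; linarith [Literature.NumberTheory.Sieve.CubicSieve.four_le_exp_two]
  have hx1 : 1 < x := by linarith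
  have hpow : ∀ a : ℝ, x ^ a = Real.exp (a * Real.exp t) := by
    intro a; rw [Real.rpow_def_of_pos hx0, hlogx, mul_comm]
  refine ⟨hx4, ?_, ?_, Real.rpow_le_rpow_of_exponent_le hx1.le (by nlinarith),
    Real.rpow_le_rpow_of_exponent_le hx1.le (by nlinarith), Real.one_lt_rpow hx1 (by norm_num),
    Real.rpow_le_rpow_of_exponent_le hx1.le (by linarith),
    Real.rpow_le_rpow_of_exponent_le hx1.le (by linarith), Real.one_le_rpow hx1.le (by norm_num),
    by rw [Real.log_rpow hx0, hlogx], by rw [Real.log_rpow hx0, hlogx], hlogx, by rw [hpow]; ring_nf⟩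
  · have h1 : Real.exp 1 ≤ Real.exp (t ^ 2) := Real.exp_le_exp.2 (by nlinarith)
    have h2 : (2 : ℝ) < Real.exp 1 := by have := Real.exp_one_gt_d9; linarith
    linarith
  · rw [hpow]
    refine Real.exp_le_exp.2 ?_
    have : t ^ 2 = ε ^ 2 * (1 / ε ^ 2 * t ^ 2) := by field_simp
    rw [this]; exact mul_le_mul_of_nonneg_left hT₂ hε2.le

/-- **The Bombieri–Vinogradov level.**  For `X' ∈ [x^{3/8}, 2x+2]` (`x = e^{e^t}`,
`16B t + 16B log 2 ≤ e^t`, `(8/3) max(X₀,1) ≤ t`): `X₀ ≤ X'`, `x^{1/8} ≤ X'^{1/2}/(log X')^B` and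
`log X' ≥ (3/8) log x`. -/
theorem twisted_level {B X₀ : ℝ} (hB : 0 < B) {x t : ℝ} (hx4 : 4 ≤ x)
    (hxexp : Real.exp (Real.exp t) = x)
    (hT₃ : 16 * B * t + 16 * B * Real.log 2 ≤ Real.exp t) (hX₀ : 8 / 3 * max X₀ 1 ≤ t)
    {X' : ℝ} (h1 : Real.exp (3 / 8 * Real.exp t) ≤ X') (h2 : X' ≤ 2 * x + 2) :
    X₀ ≤ X' ∧ x ^ ((1 : ℝ) / 8) ≤ X' ^ (1 / 2 : ℝ) / Real.log X' ^ B ∧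
      3 / 8 * Real.log x ≤ Real.log X' := by
  have hx0 : 0 < x := by linarith
  have hlogx : Real.log x = Real.exp t := by rw [← hxexp, Real.log_exp]
  have hX'0 : 0 < X' := (Real.exp_pos _).trans_le h1
  have hlogX' : 3 / 8 * Real.exp t ≤ Real.log X' := by
    rw [← Real.log_exp (3 / 8 * Real.exp t)]; exact Real.log_le_log (Real.exp_pos _) h1
  have het : t + 1 ≤ Real.exp t := Real.add_one_le_exp t
  have hlogX'0 : 0 < Real.log X' := lt_of_lt_of_le (by positivity) hlogX'
  refine ⟨?_, ?_, by rw [hlogx]; exact hlogX'⟩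
  · have e1 : 3 / 8 * Real.exp t + 1 ≤ X' := (Real.add_one_le_exp _).trans h1
    linarith [le_max_left X₀ 1]
  · have hL : x ^ ((1 : ℝ) / 8) = Real.exp (1 / 8 * Real.exp t) := by
      rw [Real.rpow_def_of_pos hx0, hlogx, mul_comm]
    have hL0 : 0 < x ^ ((1 : ℝ) / 8) := by rw [hL]; exact Real.exp_pos _
    have hlog2x : Real.log (2 * x + 2) ≤ 2 * Real.exp t := by
      rw [← hlogx]
      have e1 : 2 * x + 2 ≤ x ^ 2 := by nlinarith
      calc Real.log (2 * x + 2) ≤ Real.log (x ^ 2) := Real.log_le_log (by positivity) e1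
        _ = 2 * Real.log x := by rw [Real.log_pow]; push_cast; ring
    have hlogX'le : Real.log X' ≤ 2 * Real.exp t := (Real.log_le_log hX'0 h2).trans hlog2x
    have hnum : x ^ ((1 : ℝ) / 8) * Real.log X' ^ B ≤ Real.exp (3 / 16 * Real.exp t) := by
      have e1 : Real.log X' ^ B ≤ (2 * Real.exp t) ^ B :=
        Real.rpow_le_rpow hlogX'0.le hlogX'le hB.le
      have e2 : (2 * Real.exp t) ^ B = Real.exp (B * Real.log 2 + B * t) := by
        rw [Real.rpow_def_of_pos (by positivity), Real.log_mul (by norm_num) (Real.exp_pos t).ne',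
          Real.log_exp]; ring_nf
      calc x ^ ((1 : ℝ) / 8) * Real.log X' ^ B ≤ x ^ ((1 : ℝ) / 8) * (2 * Real.exp t) ^ B :=
            mul_le_mul_of_nonneg_left e1 hL0.le
        _ = Real.exp (1 / 8 * Real.exp t + (B * Real.log 2 + B * t)) := by
            rw [e2, hL, ← Real.exp_add]
        _ ≤ Real.exp (3 / 16 * Real.exp t) := Real.exp_le_exp.2 (by linarith)
    have hden : Real.exp (3 / 16 * Real.exp t) ≤ X' ^ (1 / 2 : ℝ) := by
      have e1 : Real.exp (3 / 8 * Real.exp t) ^ (1 / 2 : ℝ) ≤ X' ^ (1 / 2 : ℝ) :=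
        Real.rpow_le_rpow (Real.exp_pos _).le h1 (by norm_num)
      rw [← Real.exp_mul] at e1
      have e2 : 3 / 8 * Real.exp t * (1 / 2 : ℝ) = 3 / 16 * Real.exp t := by ring
      rwa [e2] at e1
    rw [le_div_iff₀ (Real.rpow_pos_of_pos hlogX'0 B)]
    exact hnum.trans hden

/-- **The window of one pair `(d, g)`.**  For `1 ≤ d ≤ D = x^{1/2−2ε}`, `1 ≤ g ≤ L = x^{1/8}`:
`x^{3/8} ≤ (2x+2)/(dg) ≤ 2x+2` (with `x = e^{e^t}`). -/
theorem twisted_window {ε : ℝ} (hε : 0 < ε) {x t : ℝ} (hx1 : 1 ≤ x)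
    (hxexp : Real.exp (Real.exp t) = x) {d g : ℝ} (hd1 : 1 ≤ d)
    (hdD : d ≤ x ^ ((1 : ℝ) / 2 - 2 * ε)) (hg1 : 1 ≤ g) (hgL : g ≤ x ^ ((1 : ℝ) / 8)) :
    Real.exp (3 / 8 * Real.exp t) ≤ (2 * x + 2) / (d * g) ∧ (2 * x + 2) / (d * g) ≤ 2 * x + 2 := by
  have hx0 : 0 < x := by linarith
  have hlogx : Real.log x = Real.exp t := by rw [← hxexp, Real.log_exp]
  have hpow : ∀ a : ℝ, x ^ a = Real.exp (a * Real.exp t) := by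
    intro a; rw [Real.rpow_def_of_pos hx0, hlogx, mul_comm]
  have hD0 : 0 < x ^ ((1 : ℝ) / 2 - 2 * ε) := Real.rpow_pos_of_pos hx0 _
  have hg0 : 0 < g := by linarith
  refine ⟨?_, div_le_self (by positivity) (by nlinarith)⟩
  have e1 : d * g ≤ x ^ ((1 : ℝ) / 2 - 2 * ε) * x ^ ((1 : ℝ) / 8) := mul_le_mul hdD hgL hg0.le hD0.le
  have e2 : x / (x ^ ((1 : ℝ) / 2 - 2 * ε) * x ^ ((1 : ℝ) / 8)) ≤ (2 * x + 2) / (d * g) :=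
    calc x / (x ^ ((1 : ℝ) / 2 - 2 * ε) * x ^ ((1 : ℝ) / 8)) ≤ x / (d * g) :=
          div_le_div_of_nonneg_left hx0.le (by positivity) e1
      _ ≤ (2 * x + 2) / (d * g) := div_le_div_of_nonneg_right (by linarith) (by positivity)
  have e3 : x / (x ^ ((1 : ℝ) / 2 - 2 * ε) * x ^ ((1 : ℝ) / 8)) =
      Real.exp ((3 / 8 + 2 * ε) * Real.exp t) := by
    rw [hpow, hpow, ← Real.exp_add, ← hxexp, ← Real.exp_sub]
    congr 1; ring
  have e4 : Real.exp (3 / 8 * Real.exp t) ≤ Real.exp ((3 / 8 + 2 * ε) * Real.exp t) :=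
    Real.exp_le_exp.2 (by nlinarith [Real.exp_pos t])
  linarith

/-- **Main terms.**  `16 C u e^{-u} (5C_R/2 + 1) ≤ δ/4` when `u e^{-u} ≤ η` and
`64 C (5C_R/2 + 1) η ≤ δ`; hence the total of the main terms,
`C (x S₁ + N)(16uV/ℓ) e^{-u}` with `S₁ ≤ 5C_R/2`, `N ≤ x`, is `≤ (δ/4) V x/ℓ`. -/
theorem twisted_main_le {C CR δ η u V x ℓ S₁ N : ℝ} (hC : 0 ≤ C) (hV : 0 ≤ V)
    (hx : 0 ≤ x) (hℓ : 0 < ℓ) (hu : 0 ≤ u) (hue : u * Real.exp (-u) ≤ η)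
    (hη : 64 * C * (5 / 2 * CR + 1) * η ≤ δ) (hS₁ : S₁ ≤ 5 / 2 * CR) (hS0 : 0 ≤ S₁) (hN : N ≤ x)
    (hN0 : 0 ≤ N) :
    C * (16 * u * V / ℓ) * Real.exp (-u) * (x * S₁ + N) ≤ δ / 4 * V * x / ℓ := by
  have h1 : x * S₁ + N ≤ x * (5 / 2 * CR + 1) := by nlinarith
  have h2 : C * (16 * u * V / ℓ) * Real.exp (-u) * (x * S₁ + N) =
      16 * C * (u * Real.exp (-u)) * (x * S₁ + N) * (V / ℓ) := by ring
  rw [h2]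
  have hVℓ : 0 ≤ V / ℓ := div_nonneg hV hℓ.le
  have hue0 : 0 ≤ u * Real.exp (-u) := mul_nonneg hu (Real.exp_pos _).le
  have h3 : 16 * C * (u * Real.exp (-u)) * (x * S₁ + N) ≤ 16 * C * η * (x * (5 / 2 * CR + 1)) := by
    have a1 : 16 * C * (u * Real.exp (-u)) ≤ 16 * C * η := by nlinarith
    have a2 : 0 ≤ x * S₁ + N := by positivity
    calc 16 * C * (u * Real.exp (-u)) * (x * S₁ + N) ≤ 16 * C * η * (x * S₁ + N) :=
          mul_le_mul_of_nonneg_right a1 a2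
      _ ≤ 16 * C * η * (x * (5 / 2 * CR + 1)) := by
          refine mul_le_mul_of_nonneg_left h1 ?_
          have : 0 ≤ 16 * C * (u * Real.exp (-u)) := by positivity
          linarith
  have h4 : 16 * C * η * (x * (5 / 2 * CR + 1)) ≤ δ / 4 * x := by
    have : 16 * C * η * (x * (5 / 2 * CR + 1)) = (64 * C * (5 / 2 * CR + 1) * η) / 4 * x := by ring
    rw [this]; nlinarith
  calc 16 * C * (u * Real.exp (-u)) * (x * S₁ + N) * (V / ℓ) ≤ δ / 4 * x * (V / ℓ) :=
        mul_le_mul_of_nonneg_right (h3.trans h4) hVℓ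
    _ = δ / 4 * V * x / ℓ := by ring

/-- **`L²`-terms.**  `N L² ≤ x^{3/4} ≤ (δ/4) V x/log x` for `N ≤ x^{1/2}`, `L² = x^{1/4}`,
`V ≥ c/t⁴`, `t⁴ ≤ e^t` and `8t + 4 log(4/(δc)) ≤ e^t` (`x = e^{e^t}`). -/
theorem twisted_Lsq_le {δ c V t N : ℝ} (hδ : 0 < δ) (hc : 0 < c) (ht : 0 < t)
    (hV : c / t ^ 4 ≤ V) (hT₆ : t ^ 4 ≤ Real.exp t)
    (hT₇ : 8 * t + 4 * Real.log (4 / (δ * c)) ≤ Real.exp t)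
    (hN : N ≤ Real.exp (Real.exp t / 2)) :
    N * Real.exp (1 / 8 * Real.exp t) ^ 2 ≤
      δ / 4 * V * Real.exp (Real.exp t) / Real.exp t := by
  have ht4 : 0 < t ^ 4 := by positivity
  have hδc : 0 < δ * c := by positivity
  have h1 : N * Real.exp (1 / 8 * Real.exp t) ^ 2 ≤ Real.exp (3 / 4 * Real.exp t) := by
    rw [← Real.exp_nat_mul]
    calc N * Real.exp ((2 : ℕ) * (1 / 8 * Real.exp t))
        ≤ Real.exp (Real.exp t / 2) * Real.exp ((2 : ℕ) * (1 / 8 * Real.exp t)) :=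
          mul_le_mul_of_nonneg_right hN (Real.exp_pos _).le
      _ = Real.exp (3 / 4 * Real.exp t) := by rw [← Real.exp_add]; push_cast; ring_nf
  -- `(4/(δc)) t⁴ e^t ≤ e^{e^t/4}`
  have h2 : 4 / (δ * c) * t ^ 4 * Real.exp t ≤ Real.exp (Real.exp t / 4) := by
    have e1 : 4 / (δ * c) * t ^ 4 * Real.exp t ≤ 4 / (δ * c) * Real.exp t * Real.exp t := by
      calc 4 / (δ * c) * t ^ 4 * Real.exp t = 4 / (δ * c) * Real.exp t * t ^ 4 := by ring
        _ ≤ 4 / (δ * c) * Real.exp t * Real.exp t :=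
          mul_le_mul_of_nonneg_left hT₆ (by positivity)
    have e2 : 4 / (δ * c) * Real.exp t * Real.exp t =
        Real.exp (Real.log (4 / (δ * c)) + 2 * t) := by
      rw [Real.exp_add, Real.exp_log (by positivity), show (2 : ℝ) * t = t + t by ring,
        Real.exp_add]; ring
    have e3 : Real.exp (Real.log (4 / (δ * c)) + 2 * t) ≤ Real.exp (Real.exp t / 4) :=
      Real.exp_le_exp.2 (by linarith)
    linarith
  -- compare
  have h3 : Real.exp (3 / 4 * Real.exp t) ≤ δ / 4 * (c / t ^ 4) * Real.exp (Real.exp t) / Real.exp t := by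
    rw [le_div_iff₀ (Real.exp_pos t)]
    have e1 : Real.exp (3 / 4 * Real.exp t) * Real.exp t =
        Real.exp (3 / 4 * Real.exp t) * (t ^ 4 * Real.exp t) / t ^ 4 := by field_simp
    have e2 : t ^ 4 * Real.exp t ≤ δ * c / 4 * Real.exp (Real.exp t / 4) := by
      have h := mul_le_mul_of_nonneg_left h2 (le_of_lt (by positivity : (0 : ℝ) < δ * c / 4))
      calc t ^ 4 * Real.exp t = δ * c / 4 * (4 / (δ * c) * t ^ 4 * Real.exp t) := by
            field_simp
        _ ≤ δ * c / 4 * Real.exp (Real.exp t / 4) := h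
    have e3 : Real.exp (3 / 4 * Real.exp t) * (t ^ 4 * Real.exp t) ≤
        Real.exp (3 / 4 * Real.exp t) * (δ * c / 4 * Real.exp (Real.exp t / 4)) :=
      mul_le_mul_of_nonneg_left e2 (Real.exp_pos _).le
    have e4 : Real.exp (3 / 4 * Real.exp t) * (δ * c / 4 * Real.exp (Real.exp t / 4)) =
        δ / 4 * c * Real.exp (Real.exp t) := by
      rw [show δ / 4 * c * Real.exp (Real.exp t) = δ * c / 4 * (Real.exp (3 / 4 * Real.exp t) *
        Real.exp (Real.exp t / 4)) by rw [← Real.exp_add]; ring_nf]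
      ring
    rw [e1, div_le_iff₀ ht4]
    calc Real.exp (3 / 4 * Real.exp t) * (t ^ 4 * Real.exp t)
        ≤ δ / 4 * c * Real.exp (Real.exp t) := e3.trans_eq e4
      _ = δ / 4 * (c / t ^ 4) * Real.exp (Real.exp t) * t ^ 4 := by field_simp
  have h4 : δ / 4 * (c / t ^ 4) * Real.exp (Real.exp t) / Real.exp t ≤
      δ / 4 * V * Real.exp (Real.exp t) / Real.exp t := by
    have : 0 ≤ δ / 4 * Real.exp (Real.exp t) / Real.exp t := by positivity
    have e := mul_le_mul_of_nonneg_left hV this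
    calc δ / 4 * (c / t ^ 4) * Real.exp (Real.exp t) / Real.exp t
        = δ / 4 * Real.exp (Real.exp t) / Real.exp t * (c / t ^ 4) := by ring
      _ ≤ δ / 4 * Real.exp (Real.exp t) / Real.exp t * V := e
      _ = _ := by ring
  exact h1.trans (h3.trans h4)

/-- **Remainder terms.**  `2C_BV (2x+2)(1 + log L) S₁/ℓ³ ≤ (δ/4) V x/log x` for `x = e^{e^t} ≥ 4`,
`log L = e^t/8`, `ℓ = (3/8) e^t`, `S₁ ≤ 5C_R/2`, `V ≥ c/t⁴`, `t⁴ ≤ κ e^t` with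
`κ = 9δc/(5120 (C_BV+1) C_R)`. -/
theorem twisted_rem_le {δ c Cb CR V t x S₁ : ℝ} (hδ : 0 < δ) (hc : 0 < c) (hCb : 0 ≤ Cb)
    (hCR : 0 < CR) (ht : 1 ≤ t) (hx4 : 4 ≤ x)
    (hV : c / t ^ 4 ≤ V) (hS₁ : S₁ ≤ 5 / 2 * CR) (hS0 : 0 ≤ S₁)
    (hT₅ : t ^ 4 ≤ 9 * δ * c / (5120 * (Cb + 1) * CR) * Real.exp t) :
    2 * Cb * (2 * x + 2) * (1 + 1 / 8 * Real.exp t) / (3 / 8 * Real.exp t) ^ 3 * S₁ ≤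
      δ / 4 * V * x / Real.exp t := by
  have het0 : 0 < Real.exp t := Real.exp_pos t
  have het1 : t + 1 ≤ Real.exp t := Real.add_one_le_exp t
  have ht4 : 0 < t ^ 4 := by positivity
  have hx0 : 0 < x := by linarith
  -- crude simplifications
  have he1 : Real.exp 1 ≤ Real.exp t := Real.exp_le_exp.2 ht
  have he9 := Real.exp_one_gt_d9
  have h1 : 1 + 1 / 8 * Real.exp t ≤ Real.exp t / 2 := by linarith
  have h2 : 2 * x + 2 ≤ 3 * x := by linarith
  have h3 : 2 * Cb * (2 * x + 2) * (1 + 1 / 8 * Real.exp t) / (3 / 8 * Real.exp t) ^ 3 * S₁ ≤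
      2 * (Cb + 1) * (3 * x) * (Real.exp t / 2) / (3 / 8 * Real.exp t) ^ 3 * (5 / 2 * CR) := by
    have hden : 0 < (3 / 8 * Real.exp t) ^ 3 := by positivity
    have a1 : 2 * Cb * (2 * x + 2) * (1 + 1 / 8 * Real.exp t) ≤
        2 * (Cb + 1) * (3 * x) * (Real.exp t / 2) := by
      have b1 : 2 * Cb ≤ 2 * (Cb + 1) := by linarith
      have b2 : 0 ≤ 1 + 1 / 8 * Real.exp t := by positivity
      calc 2 * Cb * (2 * x + 2) * (1 + 1 / 8 * Real.exp t)
          ≤ 2 * (Cb + 1) * (3 * x) * (1 + 1 / 8 * Real.exp t) := by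
            apply mul_le_mul_of_nonneg_right _ b2; nlinarith
        _ ≤ 2 * (Cb + 1) * (3 * x) * (Real.exp t / 2) :=
            mul_le_mul_of_nonneg_left h1 (by positivity)
    have a2 : 0 ≤ 2 * (Cb + 1) * (3 * x) * (Real.exp t / 2) / (3 / 8 * Real.exp t) ^ 3 := by positivity
    calc _ ≤ 2 * (Cb + 1) * (3 * x) * (Real.exp t / 2) / (3 / 8 * Real.exp t) ^ 3 * S₁ :=
          mul_le_mul_of_nonneg_right (div_le_div_of_nonneg_right a1 hden.le) hS0
      _ ≤ _ := mul_le_mul_of_nonneg_left hS₁ a2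
  have h4 : 2 * (Cb + 1) * (3 * x) * (Real.exp t / 2) / (3 / 8 * Real.exp t) ^ 3 * (5 / 2 * CR) =
      1280 / 9 * (Cb + 1) * CR * x / Real.exp t ^ 2 := by
    field_simp; ring
  -- the growth step: `(1280/9)(Cb+1)CR/e^{2t} ≤ (δ/4)(c/t⁴)/e^t`
  have h5 : 1280 / 9 * (Cb + 1) * CR * x / Real.exp t ^ 2 ≤ δ / 4 * (c / t ^ 4) * x / Real.exp t := by
    rw [div_le_div_iff₀ (by positivity) het0]
    have e1 : 1280 / 9 * (Cb + 1) * CR * t ^ 4 ≤ δ / 4 * c * Real.exp t := by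
      have := mul_le_mul_of_nonneg_left hT₅ (by positivity : (0:ℝ) ≤ 1280 / 9 * (Cb + 1) * CR)
      calc 1280 / 9 * (Cb + 1) * CR * t ^ 4
          ≤ 1280 / 9 * (Cb + 1) * CR * (9 * δ * c / (5120 * (Cb + 1) * CR) * Real.exp t) := this
        _ = δ / 4 * c * Real.exp t := by field_simp; ring
    have e2 := mul_le_mul_of_nonneg_left e1 (by positivity : (0:ℝ) ≤ x * Real.exp t / t ^ 4)
    calc 1280 / 9 * (Cb + 1) * CR * x * Real.exp t
        = x * Real.exp t / t ^ 4 * (1280 / 9 * (Cb + 1) * CR * t ^ 4) := by field_simp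
      _ ≤ x * Real.exp t / t ^ 4 * (δ / 4 * c * Real.exp t) := e2
      _ = δ / 4 * (c / t ^ 4) * x * Real.exp t ^ 2 := by field_simp
  have h6 : δ / 4 * (c / t ^ 4) * x / Real.exp t ≤ δ / 4 * V * x / Real.exp t := by
    have : 0 ≤ δ / 4 * x / Real.exp t := by positivity
    have e := mul_le_mul_of_nonneg_left hV this
    calc δ / 4 * (c / t ^ 4) * x / Real.exp t = δ / 4 * x / Real.exp t * (c / t ^ 4) := by ring
      _ ≤ δ / 4 * x / Real.exp t * V := e
      _ = _ := by ring
  exact h3.trans (h4.le.trans (h5.trans h6))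

end Summit.Parity.GeneralizedHardyLittlewood.Theorems.ParityLeakOneFifth
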